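import Literature.MathematicalPhysics.QuantumFieldTheory.Balaban1983to89.B9HpDGWFromPinsSN
import Literature.MathematicalPhysics.QuantumFieldTheory.Balaban1983to89.B9Eq340ProbeBridgeDstarSN
import Literature.MathematicalPhysics.QuantumFieldTheory.Balaban1983to89.B9SmoothHolderClassPClosureSN

/-!
# `Balaban1983to89.B9H43GpFromPinsSN` — T. Bałaban, *Propagators for lattice gauge theories in a background field*, Commun. Math. Phys. **99** (1985) 389–434
# [Balaban1985BackgroundPropagators], (3.43)₂ p. 398 «‖ζG′(U)∇\*_Uλ‖_β ≦ B₀(β)(Lʲη)^{1−β}(‖ζ‖_β + |ζ|)e^{−δ₀d(y,y′)}|λ|» AT THE N06 CERTIFICATE's HÖLDER INTERMEDIATE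
# `bH13 x U := bHZPG (taxiS U) w13`: the displayed rows-20–21 binder `h43Gp` ASSEMBLED from the rows-18 data at the near site carrier

[4] = T. Bałaban, *Propagators and renormalization transformations for lattice gauge theories. II*, Commun. Math. Phys. **96** (1984) 223–250 [`Balaban1984PropagatorsII`].
statement-level skeleton of published theorems with citation tags; proofs where landed; nothing here is a claim about the Yang–Mills mass gap.

THE PRINT.  Thm 3.7 p. 409 + «Theorem 3.7 implies (3.42)–(3.47)» p. 410; Thm 3.1 (3.42)₃, (3.43)₂ pp. 397–398; (3.40) p. 397; (3.35) p. 396; (3.8) p. 392; [4] (2.51)–(2.54) pp. 232–233.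

WHY THIS FILE (cell `pub-ymgap`, node N06 [B9], seat `pub-ymgap-dag-n06-c` g19; the G′ Hölder layer of rows 20–21, dag-n06-d `DISPLAY-LEDGER-UF.md` §2 binder `h43Gp`; road memo
`pub-ymgap-dag-n06-c/HPDGW-ROAD.md`; sequel of `B9HpDGWFromPinsSN`).  Per member and configuration and for EVERY `s ∈ (0,1)`: n06-k's `holder343_of_local37_dir` (RIGHT member,
`Φ^X_s ∘ (G′ ∘ ∇\*_U)` at the near site probes `𝔭 x = holderProbesSN … parSymY …`, direction-packed site source) → `hasMaj_cNormR_of_hasMajorantHom` →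
`B9Eq340ProbeTransferSNY.hasMaj_probesSN_parSY_of_parSymY` (table → `parSY = taxiS`, print's (3.35)) → `B9Eq340ProbeBridgeDstarSN.hasMaj_probesSN_GcoS_DvscoKH_of_DscoS` (source →
def-Y's bond sector `DvscoKH`, factor `d + 1`); the leaf's (3.42)₃ sup member through def-Y's `hasMajorantHom_GcoS_DvscoKH_of_compat`; and the whole `s`-family lands ONCE in dag-n06-l's
graded print-weighted class by `B9SmoothHolderClassPClosureSN.hasMaj_into_bHZPG_of_probeFamilySN_near`, given the certificate's weights `w` with a budget `w s·B_D(s) ≤ B₀D`.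
* ★★★ `h43Gp_of_thm37PrintedSN` — hypotheses as in `hpDGW_of_thm37PrintedSN` plus the `∇\*` pin `hDs`, the weights `w` and the budget; conclusion: `∃ M₂ a₀ > 0`, for every member above
  them and every regular `U`, `HasMaj (cNorm 1 (H x) (blkBK (bI x)) _ 0) (bHZPG … (taxiS … U) w …) (GcoS … (O x) U ∘ₗ DvscoKH … U) (L·((d+1)C + B₀D)·e^{δ(r_near+1)}·e^{−δd})` — the
  displayed shape of `h43Gp` at the pins `(𝔬12 x).blk = blkBK (bI x)` (`hblk12`), `bH13 x U = bHZPG (taxiS U) w13` (`hbH13`) — the binder text of `h43Gp` is byte-identical in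
  dag-n06-d's editions UF … UL (`…N06AtOpsYNuOfRecordV6EPairUF ∕ …UL`, checked 2026-08-29), source `cNorm 1 (H x) (𝔬12 x).blk _ 0`, kernel `B43·e^{−δ43 d}`.
HONEST SCOPE.  An assembler over landed theorems; Theorem 3.7's local legs, the leaf, print's class and the weight budget are HYPOTHESES; nothing of [B9] asserted; no certificate edition
written; COUNT-NEUTRAL; N06 NOT discharged; nothing continuum, nothing about the mass gap.  Cell `pub-ymgap` (HUMAN RULING D-0062), Track A node N06 [B9], seat `pub-ymgap-dag-n06-c` (g19),
2026-08-29; a NEW file; 0 `def`, no `sorry`, no `axiom`, no `instance`, no `notation`.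
-/

noncomputable section

namespace Literature.MathematicalPhysics.QuantumFieldTheory.Balaban1983to89.B9H43GpFromPinsSN

open B6RandomWalk (HasMajorant c1_nonneg Ineq261)
open B6RandomWalkHom (HasMajorantHom hasMajorantHom_mono)
open B6GlobalChartV1 (PV blkV1)
open B6Geom246MultiLevelTorus (geomT)
open B6Ineq2142KLevelV1 (lvl β)
open B6KLevelCensusIndexV1 (KIdx kGeo)
open B6Prop22KLevelTorusCensusEta (nKT nKT_pos)
open B9Thm34Ext (toB6)
open B9Thm37Whole (Ops Conv342 Sizes StaticOK Local342)
open B9RWSums346SecondDiffGp (DirOps37)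
open B9Thm37WholeDir (DirLetters37 DirSupSq37 Identities₂)
open B9Thm37KLetterDir (HolderV37Dir)
open B9RWSums343Holder (HolderProbes holderConst)
open B9RWSums343HolderGp (HolderLegs37)
open B9RWSums343HolderGpDir (holder343_of_local37_dir)
open B9RWSums347DefiniteFaces (exp261 lemma21Pack_geo9Y)
open B9GeoLemma21KLevelV1 (geo9Y_len_pos geo9Y_dist_triangle geo9Y_dist_comm)
open B9GeoNormsKLevelV1 (geo9K geo9K_dist_nonneg)
open B9PinMembersKLevelV1 (MemberY geo9Y)
open B9Thm39ReadingCoords (coordBound39 basisBound39)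
open B9CoReadingCoords (XBK blkBK)
open B9CoReadingCoordsS (XSK blkSK sIK GcoS DscoS)
open B9CoReadingCoordsHolder (PK blkPK probeK)
open B9CoReadingCoordsHolderAdm (holderProbesKA)
open B9CoReadingCoordsHolderSNear (holderProbesSN)
open B9BackgroundsKLevelV1P (bg9KP)
open Node00 (SiteY FBondY IBondY CfgY SiteOpY parSymY parSY parBY toKT etaS)
open Node00.OpsYSectDCoords (DvcoKH DvscoKH)
open B9Eq340ProbeTransferSNY (hasMaj_probesSN_parSY_of_parSymY)
open B9Eq340ProbeBridgeDstarSN (hasMaj_probesSN_GcoS_DvscoKH_of_DscoS)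
open B9SmoothHolderClassPClosureSN (hasMaj_into_bHZPG_of_probeFamilySN_near)
open B9SmoothHolderClassP (bHZPG)
open B9GradViaDivLettersTransported (taxiS)
open B9MultiscaleSmoothPartitionYNear (rNear)
open Node00.OpsYNablaBridge (compat_blkSK_blkBK hasMajorantHom_GcoS_DvscoKH_of_compat)
open B9CoReadingCoordsHolderSNear (ΦX_SN_eq blkPX_SN wSN)
open B9Thm312Whole (GeoOK cNorm)
open B9Thm312WholeClasses (cNormR cNormR_loc_neg_natCast hasMaj_cNormR_of_hasMajorantHom)
open T4RelativeLadder (UnitaryLike)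
open B11SectG (HasMaj)
open scoped Matrix.Norms.L2Operator


variable {d ℓ : ℕ} {hd : 1 ≤ d + 1} {hL : Odd (ℓ + 1) ∧ 1 < ℓ + 1} {b₀ b₁ : ℝ} {Mstar : ℕ}
variable {N : ℕ} [Nonempty (Fin N)] {κ : Type} [Fintype κ] [DecidableEq κ]
variable [∀ x : MemberY d ℓ hd hL b₀ b₁ Mstar, Fintype (geo9Y x).Site] [∀ x : MemberY d ℓ hd hL b₀ b₁ Mstar, DecidableEq (geo9Y x).Site]

/-- Arithmetic of «for M sufficiently large» (the siblings' private lemma). [folklore] -/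
private theorem small_of_size_pair {N' B₀ ex s θ₀ c M : ℝ} (hN' : 0 ≤ N') (hB : 0 ≤ B₀ * ex) (hc : 0 ≤ c) (hM : 0 < M)
    (hs : s ≤ θ₀ * M⁻¹) (hbig : 2 * N' * (B₀ * ex * θ₀) * c ≤ M) : N' * (B₀ * ex * s) * c ≤ 1 / 2 := by
  have h1 : N' * (B₀ * ex * s) * c ≤ N' * (B₀ * ex * (θ₀ * M⁻¹)) * c :=
    mul_le_mul_of_nonneg_right (mul_le_mul_of_nonneg_left (mul_le_mul_of_nonneg_left hs hB) hN') hc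
  have h2 : N' * (B₀ * ex * (θ₀ * M⁻¹)) * c = (N' * (B₀ * ex * θ₀) * c) / M := by
    rw [div_eq_mul_inv]; ring
  rw [h2] at h1
  refine h1.trans ?_
  rw [div_le_iff₀ hM]
  linarith

/-- the Hölder constant is ≧ 0 for nonnegative letters (the engine's private lemma). [folklore] -/
private theorem holderConst_nonneg' {dd : ℕ} {δ₀ α NH NF C b t : ℝ} (hNH : 0 ≤ NH) (hNF : 0 ≤ NF) (hC : 0 ≤ C) (hb : 0 ≤ b)
    (ht : 0 ≤ t) : 0 ≤ holderConst dd δ₀ α NH NF C b t := by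
  have hc1 : 0 ≤ B6.c1 dd δ₀ α := c1_nonneg dd δ₀ α
  unfold holderConst
  positivity

omit [Nonempty (Fin N)] [Fintype κ] [DecidableEq κ] [∀ x : MemberY d ℓ hd hL b₀ b₁ Mstar, Fintype (geo9Y x).Site]
  [∀ x : MemberY d ℓ hd hL b₀ b₁ Mstar, DecidableEq (geo9Y x).Site] in
/-- the record geometry is a `GeoOK` geometry. [cite: Balaban1984PropagatorsII, (2.46)–(2.47) p.231, bookkeeping] -/
private theorem geoOK_geo9Y (x : MemberY d ℓ hd hL b₀ b₁ Mstar) : GeoOK (geo9K x.toKIdx) :=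
  ⟨geo9Y_dist_triangle x, geo9Y_dist_comm x, geo9K_dist_nonneg x.toKIdx, geo9Y_len_pos x⟩

/-- ★★★ **`h43Gp` FROM THE ROWS-18 DATA AT THE NEAR SITE CARRIER.**  See the module docstring; `B_D(s)` = `(d+1)·(holderConst … (Bl s) (BV s) + 2c_bb_b(ℓ+1)e^{δr₀}θ₁C + c_bb_bC + C)`
with `θ₁ = (d+1)²·K_pl(10(ℓ+1)·a₁∕c)·(ℓ+1)⁶` (member-independent), budget `w s·B_D(s) ≤ B₀D` on `s ∈ (0,1)`.
[cite: Balaban1985BackgroundPropagators, Thm 3.7 p.409 + «Theorem 3.7 implies (3.42)–(3.47)» p.410 + (3.42)–(3.43) pp.397–398 + (3.40) p.397 + (3.35) p.396 + (3.8) p.392; Balaban1984PropagatorsII, (2.51)–(2.54) pp.232–233] -/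
theorem h43Gp_of_thm37PrintedSN {G : Subgroup (Matrix (Fin N) (Fin N) ℂ)ˣ} (hG1 : ∀ u : (Matrix (Fin N) (Fin N) ℂ)ˣ, u ∈ G → ‖(u : Matrix (Fin N) (Fin N) ℂ)‖ ≤ 1)
    {bg : MemberY d ℓ hd hL b₀ b₁ Mstar → B9.Backgrounds} (cfg : ∀ x : MemberY d ℓ hd hL b₀ b₁ Mstar, (bg x).Cfg → CfgY (Matrix (Fin N) (Fin N) ℂ) x.toKIdx)
    (b : Module.Basis κ ℝ (Matrix (Fin N) (Fin N) ℂ)) {c35 c10 : ℝ} (hc10 : c10 ≤ 10)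
    (hP : ∀ (x : MemberY d ℓ hd hL b₀ b₁ Mstar) (α₀ : ℝ) (U : (bg x).Cfg), (bg x).Reg335 c35 α₀ U →
      (bg9KP (Matrix (Fin N) (Fin N) ℂ) G x.toKIdx).Reg335 c10 α₀ (cfg x U))
    {ι Q : MemberY d ℓ hd hL b₀ b₁ Mstar → Type} [∀ x, Fintype (ι x)] [∀ x, Fintype (Q x)]
    (𝔬 : ∀ x : MemberY d ℓ hd hL b₀ b₁ Mstar, Ops (geo9Y x) (bg x) (XSK κ x.toKIdx) (XSK κ x.toKIdx) (ι x))
    (𝔡 : ∀ x : MemberY d ℓ hd hL b₀ b₁ Mstar, DirOps37 (𝔬 x) (Q x)) (𝔩 : ∀ x : MemberY d ℓ hd hL b₀ b₁ Mstar, DirLetters37 (𝔬 x) (Q x))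
    (𝔭 : ∀ x : MemberY d ℓ hd hL b₀ b₁ Mstar,
      HolderProbes (geo9Y x) (bg x) (XSK κ x.toKIdx) (XSK κ x.toKIdx) (PK (SiteY x.toKIdx) (Fin (d + 1)) κ) (PK (SiteY x.toKIdx) (Fin (d + 1)) κ))
    (H : MemberY d ℓ hd hL b₀ b₁ Mstar → Prop) (O : ∀ x : MemberY d ℓ hd hL b₀ b₁ Mstar, SiteOpY (Matrix (Fin N) (Fin N) ℂ) x.toKIdx)
    {bI : ∀ x : MemberY d ℓ hd hL b₀ b₁ Mstar, FBondY x.toKIdx → IBondY x.toKIdx}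
    (hlev : ∀ (x : MemberY d ℓ hd hL b₀ b₁ Mstar) (f : FBondY x.toKIdx), lvl x.toKIdx.hN x.toKIdx.D x.toKIdx.hk (bI x f) = (blkV1 x.toKIdx.hN x.toKIdx.D f).1.1)
    (hβ1 : ∀ (x : MemberY d ℓ hd hL b₀ b₁ Mstar) (f : FBondY x.toKIdx),
      (geomT x.toKIdx.D).dist (β x.toKIdx.hN x.toKIdx.D x.toKIdx.hk (bI x f)) (blkV1 x.toKIdx.hN x.toKIdx.D f) ≤ 1)
    (hbI0 : ∀ (x : MemberY d ℓ hd hL b₀ b₁ Mstar) (f : FBondY x.toKIdx), bI x f = bI x ⟨f.src, 0⟩)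
    (hcf : ∀ x : MemberY d ℓ hd hL b₀ b₁ Mstar, |x.toKIdx.cf| = (nKT (toKT x.toKIdx) : ℝ))
    (h𝔭 : ∀ x : MemberY d ℓ hd hL b₀ b₁ Mstar, 𝔭 x = holderProbesSN x.toKIdx b (bg x) (cfg x) (parSymY x.toKIdx) (bI x))
    (hblk : ∀ x : MemberY d ℓ hd hL b₀ b₁ Mstar, (𝔬 x).blk = blkSK x.toKIdx (sIK x.toKIdx (bI x)))
    (hblkY : ∀ x : MemberY d ℓ hd hL b₀ b₁ Mstar, (𝔬 x).blkY = blkSK x.toKIdx (sIK x.toKIdx (bI x)))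
    (hGp : ∀ (x : MemberY d ℓ hd hL b₀ b₁ Mstar) (U : (bg x).Cfg), (𝔬 x).Gp U = GcoS x.toKIdx b (bg x) (cfg x) (O x) U)
    (hDs : ∀ (x : MemberY d ℓ hd hL b₀ b₁ Mstar) (U : (bg x).Cfg), (𝔬 x).Dstar U = DscoS x.toKIdx b (bg x) (cfg x) U)
    (κS : MemberY d ℓ hd hL b₀ b₁ Mstar → Sizes) (SH : ∀ x : MemberY d ℓ hd hL b₀ b₁ Mstar, ι x → Finset (geo9Y x).Site)
    {α ρ Nn N' Cℓ Kc θ₀ B₀ δ₀ a₁ M₁ NH αF C δ : ℝ} (Bl BV : ℝ → ℝ)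
    (hc : 0 < c35) (hα : 0 < α) (hα2 : α < 1 / 2) (hN' : 0 ≤ N') (hNH : 0 ≤ NH) (hB₀ : 0 < B₀) (hδ₀ : 0 < δ₀) (ha₁ : 0 < a₁) (hM₁ : 0 < M₁)
    (hαF : 0 < αF) (hαF1 : αF < 1) (hC : 0 ≤ C) (hδnn : 0 ≤ δ) (hδle : δ ≤ (1 - α) * δ₀)
    (hBl : ∀ β', 0 ≤ β' → β' < 1 → 0 ≤ Bl β') (hBV : ∀ β', 0 ≤ β' → β' < 1 → 0 ≤ BV β')
    (hst : ∀ x, StaticOK (𝔬 x) ρ Nn N' Cℓ (κS x)) (hκ : ∀ x, (κS x).Bounded Kc θ₀ Cℓ (geo9Y x).M)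
    (hcntH : ∀ x (a : (geo9Y x).Site), (∑ q, if a ∈ SH x q then (1 : ℝ) else 0) ≤ NH)
    (hop : ∀ x, M₁ ≤ (geo9Y x).M → ∀ α₀ : ℝ, 0 < α₀ → c35 * (geo9Y x).M * α₀ ≤ a₁ →
      ∀ U : (bg x).Cfg, (bg x).Reg335 c35 α₀ U →
        Local342 (𝔬 x) 1 (H x) B₀ δ₀ U ∧ DirSupSq37 (𝔬 x) (𝔡 x) 1 (H x) U ∧ Identities₂ (𝔬 x) (𝔡 x) (𝔩 x) 1 (H x) U ∧
          HolderLegs37 (𝔬 x) (𝔭 x) 1 (H x) (SH x) Bl δ₀ U ∧ HolderV37Dir (𝔬 x) (𝔡 x) (𝔩 x) (𝔭 x) 1 (H x) BV δ₀ U)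
    (E : ∀ x : MemberY d ℓ hd hL b₀ b₁ Mstar, B9.RWExpansion (geo9Y x) (bg x)) (t37 : B9.Thm37Printed c35 (fun x => geo9Y x) bg E)
    (hconv : ∀ (x : MemberY d ℓ hd hL b₀ b₁ Mstar) (U : (bg x).Cfg), (E x).Converges U → Conv342 (𝔬 x) 1 (H x) C δ U)
    (w : ℝ → ℝ) (hw0 : ∀ s, 0 ≤ w s) (hw1 : ∀ s, w s ≤ 1) {B₀D : ℝ} (hB₀D : 0 ≤ B₀D)
    (hbud : ∀ s : ℝ, 0 < s → s < 1 → w s *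
      ((((d + 1 : ℕ) : ℝ)) * (holderConst (exp261 (@geo9Y d ℓ hd hL b₀ b₁ Mstar) δ₀ α) δ₀ α NH N' C (Bl s) (BV s) +
          2 * coordBound39 b * basisBound39 b * ((ℓ : ℝ) + 1) * Real.exp (δ * (((d : ℝ) + 1) * (((ℓ : ℝ) + 1) + 1) + 2)) *
            ((((d + 1 : ℕ) : ℝ)) ^ 2 * (2 * (10 * ((ℓ + 1 : ℕ) : ℝ) * (a₁ / c35)) * (1 + 10 * ((ℓ + 1 : ℕ) : ℝ) * (a₁ / c35)) *
              Real.exp (4 * (10 * ((ℓ + 1 : ℕ) : ℝ) * (a₁ / c35)))) * ((ℓ + 1 : ℕ) : ℝ) ^ 6) * C +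
          coordBound39 b * basisBound39 b * C + C)) ≤ B₀D) :
    ∃ M₂ a₀ : ℝ, 0 < M₂ ∧ 0 < a₀ ∧
      ∀ x : MemberY d ℓ hd hL b₀ b₁ Mstar, letI : Fintype (geo9K x.toKIdx).Site := (inferInstance : Fintype (geo9Y x).Site)
        M₂ ≤ (geo9Y x).M → ∀ α₀ : ℝ, 0 < α₀ → (geo9Y x).M * α₀ ≤ a₀ →
        ∀ U : (bg x).Cfg, (bg x).Reg335 c35 α₀ U →
          HasMaj (cNorm 1 (H x) (blkBK x.toKIdx (bI x)) (geoOK_geo9Y x).lenle 0)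
            (bHZPG (κ := κ) x.toKIdx b (taxiS x.toKIdx (bg x) (cfg x) U) (R := (1 : ℝ)) (H := H x) w hw0 hw1)
            (GcoS x.toKIdx b (bg x) (cfg x) (O x) U ∘ₗ DvscoKH x.toKIdx b (bg x) (cfg x) U)
            (fun a a' => (((ℓ + 1 : ℕ) : ℝ)) * ((((d + 1 : ℕ) : ℝ)) * C + B₀D) * Real.exp (δ * (rNear d ℓ + 1)) * Real.exp (-(δ * (geo9Y x).dist a a'))) := by
  classical
  -- the leaf's thresholds and the record's (2.61) threshold
  obtain ⟨M₂, a₂, hM₂, ha₂, h37⟩ := t37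
  obtain ⟨Mth, h261, -, -⟩ := lemma21Pack_geo9Y (d := d) (ℓ := ℓ) (hd := hd) (hL := hL) (b₀ := b₀) (b₁ := b₁) (Mstar := Mstar) H hα hα2 hδ₀ hαF hαF1
  set dE : ℕ := exp261 (@geo9Y d ℓ hd hL b₀ b₁ Mstar) δ₀ α with hdE
  have hc1 : 0 ≤ B6.c1 dE δ₀ α := c1_nonneg dE δ₀ α
  have hBe : 0 ≤ B₀ * Real.exp (δ₀ * ρ) := mul_nonneg hB₀.le (Real.exp_nonneg _)
  set Mbig : ℝ := 2 * N' * (B₀ * Real.exp (δ₀ * ρ) * θ₀) * B6.c1 dE δ₀ α with hMbig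
  refine ⟨max (max M₂ M₁) (max Mth Mbig), min a₂ (a₁ / c35), lt_max_of_lt_left (lt_max_of_lt_left hM₂), lt_min ha₂ (div_pos ha₁ hc), ?_⟩
  intro x
  letI : Fintype (geo9K x.toKIdx).Site := (inferInstance : Fintype (geo9Y x).Site)
  intro hM α₀ hα₀ hMa U hU
  have hM₂x : M₂ ≤ (geo9Y x).M := le_trans (le_trans (le_max_left _ _) (le_max_left _ _)) hM
  have hM₁x : M₁ ≤ (geo9Y x).M := le_trans (le_trans (le_max_right _ _) (le_max_left _ _)) hM
  have hMthx : Mth ≤ (geo9Y x).M := le_trans (le_trans (le_max_left _ _) (le_max_right _ _)) hM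
  have hMb : Mbig ≤ (geo9Y x).M := le_trans (le_trans (le_max_right _ _) (le_max_right _ _)) hM
  have hMpos : 0 < (geo9Y x).M := lt_of_lt_of_le hM₁ hM₁x
  have hMa₂ : (geo9Y x).M * α₀ ≤ a₂ := hMa.trans (min_le_left _ _)
  have hMa₁ : (geo9Y x).M * α₀ ≤ a₁ / c35 := hMa.trans (min_le_right _ _)
  have ha : c35 * (geo9Y x).M * α₀ ≤ a₁ := by
    have h2 : (geo9Y x).M * α₀ * c35 ≤ a₁ := (le_div_iff₀ hc).mp hMa₁
    calc c35 * (geo9Y x).M * α₀ = (geo9Y x).M * α₀ * c35 := by ring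
      _ ≤ a₁ := h2
  -- the leaf: (3.42)'s sup majorants of the sum; the local inputs and the smallness
  have hconvU : Conv342 (𝔬 x) 1 (H x) C δ U := hconv x U (h37 x hM₂x α₀ hα₀ hMa₂ U hU)
  obtain ⟨-, -, h2, -⟩ := hconvU
  obtain ⟨hl, hT, hid, hLg, hV⟩ := hop x hM₁x α₀ hα₀ ha U hU
  have hq : N' * (B₀ * Real.exp (δ₀ * ρ) * ((κS x).kP + (κS x).kC)) * B6.c1 dE δ₀ α ≤ 1 / 2 :=
    small_of_size_pair hN' hBe hc1 hMpos (hκ x).row (by rw [hMbig] at hMb; exact hMb)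
  have hGeo : GeoOK (geo9K x.toKIdx) := geoOK_geo9Y x
  have hγ1 : |x.toKIdx.cf| * etaS x.toKIdx = 1 := by
    rw [hcf x]; unfold etaS
    exact mul_inv_cancel₀ (nKT_pos (toKT x.toKIdx)).ne'
  have hcb : 0 ≤ coordBound39 b := by unfold coordBound39; exact norm_nonneg _
  have hbb : 0 ≤ basisBound39 b := Finset.sum_nonneg fun _ _ => norm_nonneg _
  have hL1' : (1 : ℝ) ≤ (kGeo x.toKIdx).L := B9Eq335PlaquetteAtLettersY.one_le_L x.toKIdx
  -- print's class and unitarity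
  have hreg := hP x α₀ U hU
  have hMα : 0 ≤ (kGeo x.toKIdx).M * α₀ := by
    have : (kGeo x.toKIdx).M = (geo9Y x).M := rfl
    rw [this]; exact (mul_pos hMpos hα₀).le
  -- (3.42)₃: the sup member of `G′ ∘ ∇\*_U`, direction-packed and on the bond source
  have hS2 : HasMajorantHom (g := toB6 (geo9Y x) 1 (H x)) (blkSK x.toKIdx (sIK x.toKIdx (bI x))) (blkSK x.toKIdx (sIK x.toKIdx (bI x)))
      (GcoS x.toKIdx b (bg x) (cfg x) (O x) U ∘ₗ DscoS x.toKIdx b (bg x) (cfg x) U)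
      (fun a a' => C * (geo9Y x).len a * Real.exp (-(δ * (geo9Y x).dist a a'))) := by
    have h := h2
    rw [hblk x, hblkY x, hGp x, hDs x] at h
    exact h
  have hS2' : HasMajorantHom (g := toB6 (geo9Y x) 1 (H x)) (blkSK x.toKIdx (sIK x.toKIdx (bI x))) (blkSK x.toKIdx (sIK x.toKIdx (bI x)))
      (GcoS x.toKIdx b (bg x) (cfg x) (O x) U ∘ₗ DscoS x.toKIdx b (bg x) (cfg x) U)
      (fun a a' => (C * Real.exp (-(δ * (geo9Y x).dist a a'))) * (geo9Y x).len a ^ (1 : ℝ) * (geo9Y x).len a' ^ (0 : ℝ)) :=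
    hasMajorantHom_mono (g := toB6 (geo9Y x) 1 (H x)) _ _ hS2 fun a a' => le_of_eq (by rw [Real.rpow_zero, Real.rpow_one]; ring)
  have hsupS := hasMaj_cNormR_of_hasMajorantHom (R₀ := 1) (H₀ := H x) hGeo (C := fun a a' => C * Real.exp (-(δ * (geo9Y x).dist a a')))
    (fun a a' => mul_nonneg hC (Real.exp_nonneg _)) 1 0 hS2'
  have hSB := compat_blkSK_blkBK (κ := κ) x.toKIdx (bI := bI x) (fun s μ => hbI0 x ⟨s, μ⟩)
  have hB2 := hasMajorantHom_GcoS_DvscoKH_of_compat x.toKIdx b (bg x) (cfg x) (O x) hSB U hS2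
  have hC' : 0 ≤ (((d + 1 : ℕ) : ℝ)) * C := by positivity
  have hB2' : HasMajorantHom (g := toB6 (geo9Y x) 1 (H x)) (blkBK x.toKIdx (bI x)) (blkSK x.toKIdx (sIK x.toKIdx (bI x)))
      (GcoS x.toKIdx b (bg x) (cfg x) (O x) U ∘ₗ DvscoKH x.toKIdx b (bg x) (cfg x) U)
      (fun a a' => ((((d + 1 : ℕ) : ℝ)) * C * Real.exp (-(δ * (geo9Y x).dist a a'))) * (geo9Y x).len a ^ (1 : ℝ) * (geo9Y x).len a' ^ (0 : ℝ)) :=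
    hasMajorantHom_mono (g := toB6 (geo9Y x) 1 (H x)) _ _ hB2 fun a a' => le_of_eq (by rw [hγ1, Real.rpow_zero, Real.rpow_one]; ring)
  have hsupB := hasMaj_cNormR_of_hasMajorantHom (R₀ := 1) (H₀ := H x) hGeo
    (C := fun a a' => (((d + 1 : ℕ) : ℝ)) * C * Real.exp (-(δ * (geo9Y x).dist a a'))) (fun a a' => mul_nonneg hC' (Real.exp_nonneg _)) 1 0 hB2'
  -- (3.43)₂ for every `s ∈ (0,1)`: engine → currency → transporter change → `∇\*` bridge → uniform constant
  set θ₁ : ℝ := (((d + 1 : ℕ) : ℝ)) ^ 2 * (2 * (10 * ((ℓ + 1 : ℕ) : ℝ) * (a₁ / c35)) * (1 + 10 * ((ℓ + 1 : ℕ) : ℝ) * (a₁ / c35)) *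
    Real.exp (4 * (10 * ((ℓ + 1 : ℕ) : ℝ) * (a₁ / c35)))) * ((ℓ + 1 : ℕ) : ℝ) ^ 6 with hθ₁
  set r₀ : ℝ := 2 * coordBound39 b * basisBound39 b * ((ℓ : ℝ) + 1) * Real.exp (δ * (((d : ℝ) + 1) * (((ℓ : ℝ) + 1) + 1) + 2)) with hr₀
  have hr₀0 : 0 ≤ r₀ := by rw [hr₀]; positivity
  have hθ₁0 : 0 ≤ θ₁ := by rw [hθ₁]; positivity
  have hfam : ∀ s : ℝ, 0 < s → s < 1 →
      HasMaj (cNormR 1 (H x) (blkBK x.toKIdx (bI x)) hGeo.lenle 0) (cNormR 1 (H x) (blkPK (sIK x.toKIdx (bI x))) hGeo.lenle (s - 1))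
        (probeK b (fun z z' : SiteY x.toKIdx => parSY x.toKIdx (cfg x U) z z') (wSN x.toKIdx s) (fun _ => (1 : ℝ)) ∘ₗ
          (GcoS x.toKIdx b (bg x) (cfg x) (O x) U ∘ₗ DvscoKH x.toKIdx b (bg x) (cfg x) U))
        (fun a a' => ((((d + 1 : ℕ) : ℝ)) * (holderConst dE δ₀ α NH N' C (Bl s) (BV s) + r₀ * θ₁ * C + coordBound39 b * basisBound39 b * C + C)) *
          Real.exp (-(δ * (geo9K x.toKIdx).dist a a'))) := by
    intro s hs0 hs1
    set hcβ : ℝ := holderConst dE δ₀ α NH N' C (Bl s) (BV s) with hhcβ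
    have hhc0 : 0 ≤ hcβ := by rw [hhcβ]; exact holderConst_nonneg' hNH hN' hC (hBl s hs0.le hs1) (hBV s hs0.le hs1)
    -- n06-k's RIGHT Hölder member at the near site probes, read at the pins
    have hH := (holder343_of_local37_dir (𝔬 x) (𝔡 x) (𝔩 x) (𝔭 x) 1 (H x) dE δ₀ α ρ B₀ Nn N' Cℓ NH C δ (κS x) (SH x) Bl BV U hB₀.le hδ₀.le hα.le
      (by linarith) hN' hNH hC hδnn hδle (hst x) (hκ x).nonneg (hcntH x) hBl hBV (h261 x hMthx) hq hl hT hid hLg hV h2 s hs0.le hs1).2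
    have hR1 : HasMajorantHom (g := toB6 (geo9Y x) 1 (H x)) (blkSK x.toKIdx (sIK x.toKIdx (bI x))) (blkPK (sIK x.toKIdx (bI x)))
        ((holderProbesSN x.toKIdx b (bg x) (cfg x) (parSymY x.toKIdx) (bI x)).ΦX U s ∘ₗ
          (GcoS x.toKIdx b (bg x) (cfg x) (O x) U ∘ₗ DscoS x.toKIdx b (bg x) (cfg x) U))
        (fun a a' => (hcβ * Real.exp (-(δ * (geo9Y x).dist a a'))) * (geo9Y x).len a ^ (1 - s) * (geo9Y x).len a' ^ (0 : ℝ)) := by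
      have h := hH
      rw [hblkY x, h𝔭 x, hGp x, hDs x, blkPX_SN] at h
      refine hasMajorantHom_mono (g := toB6 (geo9Y x) 1 (H x)) _ _ h fun a a' => le_of_eq ?_
      rw [Real.rpow_zero, mul_one, hhcβ]; ring
    have hprS := hasMaj_cNormR_of_hasMajorantHom (R₀ := 1) (H₀ := H x) hGeo (C := fun a a' => hcβ * Real.exp (-(δ * (geo9Y x).dist a a')))
      (fun a a' => mul_nonneg hhc0 (Real.exp_nonneg _)) (1 - s) 0 hR1
    rw [neg_sub] at hprS
    have hs2 : s ≤ 2 := by linarith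
    have htr := hasMaj_probesSN_parSY_of_parSymY x.toKIdx b hGeo (cfg x) U hc10 hMα hreg hG1 (hlev x) (hβ1 x) (hcf x) hs0.le hs2 hC hhc0 hδnn
      hsupS hprS
    have hCt : 0 ≤ hcβ + 2 * coordBound39 b * basisBound39 b * ((ℓ : ℝ) + 1) * Real.exp (δ * (((d : ℝ) + 1) * (((ℓ : ℝ) + 1) + 1) + 2)) *
        ((((d + 1 : ℕ) : ℝ)) ^ 2 * (2 * (10 * (kGeo x.toKIdx).L * ((kGeo x.toKIdx).M * α₀)) * (1 + 10 * (kGeo x.toKIdx).L * ((kGeo x.toKIdx).M * α₀)) *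
          Real.exp (4 * (10 * (kGeo x.toKIdx).L * ((kGeo x.toKIdx).M * α₀)))) * (kGeo x.toKIdx).L ^ 6) * C +
        coordBound39 b * basisBound39 b * C + C := by positivity
    have hDst := hasMaj_probesSN_GcoS_DvscoKH_of_DscoS x.toKIdx b (cfg x) (O x) (parSY x.toKIdx) U hGeo (hbI0 x) (hcf x) hCt htr
    rw [ΦX_SN_eq] at hDst
    refine hDst.mono fun a a' => ?_
    -- `K_pl(M α₀) ≤ K_pl(a₁ ∕ c)`
    have hK : 10 * (kGeo x.toKIdx).L * ((kGeo x.toKIdx).M * α₀) ≤ 10 * (kGeo x.toKIdx).L * (a₁ / c35) := mul_le_mul_of_nonneg_left hMa₁ (by positivity)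
    have hpl := B9Eq335CoveragePAtLettersY.plaqBound_mono (C := 10 * (kGeo x.toKIdx).L * ((kGeo x.toKIdx).M * α₀)) (C' := 10 * (kGeo x.toKIdx).L * (a₁ / c35))
      (by positivity) hK
    have hmid : (((d + 1 : ℕ) : ℝ)) ^ 2 * (2 * (10 * (kGeo x.toKIdx).L * ((kGeo x.toKIdx).M * α₀)) * (1 + 10 * (kGeo x.toKIdx).L * ((kGeo x.toKIdx).M * α₀)) *
          Real.exp (4 * (10 * (kGeo x.toKIdx).L * ((kGeo x.toKIdx).M * α₀)))) * (kGeo x.toKIdx).L ^ 6 ≤ θ₁ := by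
      rw [hθ₁]
      exact mul_le_mul_of_nonneg_right (mul_le_mul_of_nonneg_left hpl (by positivity)) (by positivity)
    have hE0 := Real.exp_nonneg (-(δ * (geo9K x.toKIdx).dist a a'))
    have hfac : 0 ≤ 2 * coordBound39 b * basisBound39 b * ((ℓ : ℝ) + 1) * Real.exp (δ * (((d : ℝ) + 1) * (((ℓ : ℝ) + 1) + 1) + 2)) := by positivity
    refine mul_le_mul_of_nonneg_right (mul_le_mul_of_nonneg_left ?_ (by positivity)) hE0
    have := mul_le_mul_of_nonneg_right (mul_le_mul_of_nonneg_left hmid hfac) hC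
    rw [hr₀]
    linarith
  -- the budget at the uniform constant, and the landing in the graded class
  have hBD0 : ∀ s : ℝ, 0 < s → s < 1 →
      0 ≤ (((d + 1 : ℕ) : ℝ)) * (holderConst dE δ₀ α NH N' C (Bl s) (BV s) + r₀ * θ₁ * C + coordBound39 b * basisBound39 b * C + C) := by
    intro s hs0 hs1
    have := holderConst_nonneg' (dd := dE) (δ₀ := δ₀) (α := α) hNH hN' hC (hBl s hs0.le hs1) (hBV s hs0.le hs1)
    positivity
  have hbud' : ∀ s : ℝ, 0 < s → s < 1 →
      w s * ((((d + 1 : ℕ) : ℝ)) * (holderConst dE δ₀ α NH N' C (Bl s) (BV s) + r₀ * θ₁ * C + coordBound39 b * basisBound39 b * C + C)) ≤ B₀D := by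
    intro s hs0 hs1
    exact hbud s hs0 hs1
  have hfin := hasMaj_into_bHZPG_of_probeFamilySN_near x.toKIdx b (fun z z' : SiteY x.toKIdx => parSY x.toKIdx (cfg x U) z z') hGeo.lenle w hw0 hw1
    (hβ1 x) (hlev x) hδnn (hcf x) hC' hB₀D hBD0 hbud' hsupB hfam
  -- the source in the certificate's integer-weight currency `cNorm … 0`, the table by its name `taxiS`
  intro y' μ hμ y
  have h0 : (cNormR 1 (H x) (blkBK x.toKIdx (bI x)) hGeo.lenle 0).loc y' μ = (cNorm 1 (H x) (blkBK x.toKIdx (bI x)) hGeo.lenle 0).loc y' μ := by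
    rw [← cNormR_loc_neg_natCast hGeo (blkBK x.toKIdx (bI x)) 0 y' μ, Nat.cast_zero, neg_zero]
  have h := hfin y' μ hμ y
  rw [h0] at h
  exact h

end Literature.MathematicalPhysics.QuantumFieldTheory.Balaban1983to89.B9H43GpFromPinsSN

end
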